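import Mathlib.Analysis.SpecialFunctions.ExpDeriv
import Mathlib.MeasureTheory.Integral.IntervalIntegral.FundThmCalculus
import Literature.Analysis.FluidPDE.ExtremeGrowthPowerRate
import HarnessLib

/-!
# The forced power comparison lemma of Dashti–Robinson (2008, Lemma 1), every integer power

Analysis/ODE proof file (theorems only; no definitions, no named facts, no `sorry`).

M. Dashti, J. C. Robinson, SIAM J. Numer. Anal. 46 (2008), §2 "General ODE lemma", Lemma 1
(arXiv:math/0701341, p. 4): "Let `T > 0`, `α > 0` and `n > 1` be constants and let `δ(t)` be a
non-negative continuous function on `[0, T]`. Let `y` satisfy the differential inequality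
`dy/dt ≤ δ(t) + αyⁿ` with `y(0) = y₀ > 0` and define `η = y₀ + ∫₀ᵀ δ(s) ds`. (i) If
`η < 1/[(n−1)αT]^{1/(n−1)}` then `y(t)` remains bounded on `[0, T]` … (ii) `y(t) → 0` uniformly on
`[0, T]` as `η → 0`." The printed proof compares `y` with the solution of `ż = αzⁿ`,
`z(0) = η`, i.e. `z(t) = η/(1 − (n−1)αη^{n−1}t)^{1/(n−1)}`; this gives the explicit bound
`y(t) ≤ η/(1 − (n−1)αη^{n−1}t)^{1/(n−1)}` under (i), which is the form vendored here. The case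
`n = 3` is Robinson–Rodrigo–Sadowski 2016, Lemma 9.2 / Exercise 9.2 (the tree's
`le_div_sqrt_of_hasDerivWithinAt_le_cube_add` and `robustness_comparison_integral`,
`TorusNSAPosterioriRegularity`); the unforced integer-power comparison is the tree's
`pow_le_pow_div_of_hasDerivWithinAt_le_pow_succ` (`ExtremeGrowthPowerRate`), on which this file
builds.

Every INTEGER power `n + 1 ≥ 2` (exponent written `n + 1`, `0 < n`), in ROOT-FREE form (the
`n`-th power of the printed bound, so that no real root appears), with one-sided derivatives
within `[0, t]` and the forcing given through an accumulated envelope `Φ` (`Φ' = φ ≥ 0`):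

* `pow_le_pow_div_of_hasDerivWithinAt_le_pow_succ_add` — **Lemma 1 (i), explicit**: if `Z ≥ 0`,
  `Z' ≤ βZⁿ⁺¹ + φ` on `[0, t]` (`β ≥ 0`), `η = Z(0) + Φ(t) − Φ(0)` and `nβηⁿt < 1`, then
  `Z(t)ⁿ ≤ ηⁿ/(1 − nβηⁿt)` (proof: `W = Z + (Φ(t) − Φ) + ε > 0` has `W' ≤ βWⁿ⁺¹`; the unforced
  comparison; `ε → 0⁺`).
* `pow_le_of_hasDerivWithinAt_le_linear_add_pow_succ_add` — **with a linear term (integrating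
  factor)**: `X ≥ 0`, `X' ≤ λX + βXⁿ⁺¹ + ψ`, `Λ' = λ`, `Λ(0) = 0`, `Λ ≤ L`, `Φ' = φ ≥ e^{−Λ}ψ`,
  `Φ(0) = 0`, `η = X(0) + Φ(t)`: if `nβe^{nL}ηⁿt < 1` then
  `X(t)ⁿ ≤ e^{nΛ(t)}ηⁿ/(1 − nβe^{nL}ηⁿt)` (Dashti–Robinson, proofs of Thms 1–2: `y = e^{−Λ}X`
  obeys `y' ≤ βe^{nΛ}yⁿ⁺¹ + e^{−Λ}ψ`).
* `pow_le_of_integral_balance_le_linear_add_pow_succ_add` — the same from an INTEGRAL balance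
  `X(b) = X(0) + ∫₀ᵇ F`, `F ≤ λX + βXⁿ⁺¹ + ψ` with `λ, ψ ≥ 0` continuous (the `C¹` super-solution
  `X̂ = X(0) + ∫₀(λX + βXⁿ⁺¹ + ψ) ≥ X`; the shape energy methods produce), for every `s ∈ [0, T]`
  under `nβe^{nΛ(T)}ηⁿT < 1`, `η = X(0) + Φ(T)`.

Scope: `n > 1` real in the paper; here every integer exponent `≥ 2`.
-- TODO(general form): real exponent `p > 1` (`Real.rpow`), bound `η/(1 − (p−1)βη^{p−1}t)^{1/(p−1)}`.

Consumer: the `H²`-level robustness / a-posteriori estimates for Navier–Stokes (Dashti–Robinson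
Thm 2: `dy/dt ≤ δ + αy³` for `y = ‖w‖_{H²}`, i.e. exponent `2` for `y²`; cell `ns-blowup`,
stmt-NavierStokesRegularity-19179, strain-currency door), where the tree's cubic (`n = 2`)
comparison does not apply. WHAT THIS IS NOT: a statement about any PDE — pure one-variable calculus.

## Mathlib / tree search

Tree: `pow_le_pow_div_of_hasDerivWithinAt_le_pow_succ` (`ExtremeGrowthPowerRate`, unforced, every
integer power), `le_div_sqrt_of_hasDerivWithinAt_le_cube_add`, `robustness_comparison_integral`
(`TorusNSAPosterioriRegularity`, `n = 2` only), `robustness_comparison_of_integral_balance`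
(`NSRobustnessOfRegularity`, `n = 2` only). Mathlib: `monotoneOn_of_deriv_nonneg`,
`intervalIntegral.integral_hasDerivWithinAt_right`, `intervalIntegral.integral_mono_on`,
`ge_of_tendsto`. `lean search 'Bihari|bernoulli.*comparison|hasDerivWithinAt_le_pow'`: nothing forced
beyond the cube.

## References

* M. Dashti, J. C. Robinson, *An a posteriori condition on the numerical approximations of the
  Navier–Stokes equations for the existence of a strong solution*, SIAM J. Numer. Anal. 46 (2008)
  3136–3150, Lemma 1 (arXiv:math/0701341, §2, p. 4). [DashtiRobinson2008]
* J. C. Robinson, J. L. Rodrigo, W. Sadowski, *The Three-Dimensional Navier–Stokes Equations*,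
  CUP 2016, Lemma 9.2 and Exercise 9.2 (pp. 183, 190). [RobinsonRodrigoSadowskiCUP2016]
-/

noncomputable section

open Set Filter Topology MeasureTheory

namespace Literature.Analysis.ODE

/-! ## §1 Calculus helpers -/

/-- An accumulated envelope with nonnegative density (one-sided derivatives within `[0, T]`) is
monotone on `[0, T]`. [folklore] -/
private theorem fpc_monotoneOn_of_hasDerivWithinAt_nonneg {Λ l : ℝ → ℝ} {T : ℝ}
    (hΛ : ∀ t ∈ Icc 0 T, HasDerivWithinAt Λ (l t) (Icc 0 T) t) (hl : ∀ t ∈ Icc 0 T, 0 ≤ l t) :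
    MonotoneOn Λ (Icc 0 T) := by
  have hc : ContinuousOn Λ (Icc 0 T) := fun t ht => (hΛ t ht).continuousWithinAt
  refine _root_.monotoneOn_of_deriv_nonneg (convex_Icc 0 T) hc ?_ ?_
  · rw [interior_Icc]
    intro t ht
    exact ((hΛ t (Ioo_subset_Icc_self ht)).hasDerivAt
      (Icc_mem_nhds ht.1 ht.2)).differentiableAt.differentiableWithinAt
  · rw [interior_Icc]
    intro t ht
    rw [((hΛ t (Ioo_subset_Icc_self ht)).hasDerivAt (Icc_mem_nhds ht.1 ht.2)).deriv]
    exact hl t (Ioo_subset_Icc_self ht)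

/-- FTC within `[0, T]` for a density continuous on `[0, T]`. [folklore] -/
private theorem fpc_hasDerivWithinAt_intervalIntegral {φ : ℝ → ℝ} {T t : ℝ}
    (hφ : ContinuousOn φ (Icc 0 T)) (ht : t ∈ Icc 0 T) :
    HasDerivWithinAt (fun r => ∫ x in (0 : ℝ)..r, φ x) (φ t) (Icc 0 T) t := by
  haveI : Fact (t ∈ Icc 0 T) := ⟨ht⟩
  have hint : IntervalIntegrable φ volume 0 t :=
    (hφ.mono (Icc_subset_Icc_right ht.2)).intervalIntegrable_of_Icc ht.1
  exact intervalIntegral.integral_hasDerivWithinAt_right hint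
    (hφ.stronglyMeasurableAtFilter_nhdsWithin measurableSet_Icc t) (hφ t ht)

/-! ## §2 Lemma 1 (i): the forced power comparison, root-free -/

/-- **Dashti–Robinson 2008, Lemma 1 (i), every integer power, explicit and root-free.** Let
`0 < n`, `0 < t`, `β ≥ 0`; let `Z ≥ 0` have one-sided derivatives `Z'` within `[0, t]` with
`Z' ≤ βZⁿ⁺¹ + φ`, where `φ = Φ' ≥ 0` for an envelope `Φ`; put `η = Z(0) + (Φ(t) − Φ(0))`. If
`nβηⁿt < 1` then `Z(t)ⁿ ≤ ηⁿ/(1 − nβηⁿt)` — the `n`-th power of the printed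
`y(t) ≤ η/(1 − (n'−1)αη^{n'−1}t)^{1/(n'−1)}`, `n' = n + 1`. Proof as in the tree's cube case:
`W = Z + (Φ(t) − Φ) + ε > 0` obeys `W' = Z' − φ ≤ βZⁿ⁺¹ ≤ βWⁿ⁺¹`, the unforced comparison
`pow_le_pow_div_of_hasDerivWithinAt_le_pow_succ` bounds `W(t) = Z(t) + ε`, and `ε → 0⁺`.
[cite: DashtiRobinson2008, Lemma 1 (i)] -/
theorem pow_le_pow_div_of_hasDerivWithinAt_le_pow_succ_add {Z Z' Φ φ : ℝ → ℝ} {β t : ℝ}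
    {n : ℕ} (hn : 0 < n) (ht : 0 < t) (hβ : 0 ≤ β)
    (hZ : ∀ s ∈ Icc 0 t, HasDerivWithinAt Z (Z' s) (Icc 0 t) s)
    (hΦ : ∀ s ∈ Icc 0 t, HasDerivWithinAt Φ (φ s) (Icc 0 t) s)
    (hZ0 : ∀ s ∈ Icc 0 t, 0 ≤ Z s) (hφ0 : ∀ s ∈ Icc 0 t, 0 ≤ φ s)
    (hle : ∀ s ∈ Icc 0 t, Z' s ≤ β * Z s ^ (n + 1) + φ s)
    (hsmall : n * β * (Z 0 + (Φ t - Φ 0)) ^ n * t < 1) :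
    Z t ^ n ≤ (Z 0 + (Φ t - Φ 0)) ^ n / (1 - n * β * (Z 0 + (Φ t - Φ 0)) ^ n * t) := by
  set η : ℝ := Z 0 + (Φ t - Φ 0) with hη
  have hΦmono : MonotoneOn Φ (Icc 0 t) := fpc_monotoneOn_of_hasDerivWithinAt_nonneg hΦ hφ0
  have h0I : (0 : ℝ) ∈ Icc 0 t := left_mem_Icc.2 ht.le
  have htI : t ∈ Icc 0 t := right_mem_Icc.2 ht.le
  have hη0 : 0 ≤ η := add_nonneg (hZ0 0 h0I) (sub_nonneg.2 (hΦmono h0I htI ht.le))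
  have hn0 : (0 : ℝ) < n := by exact_mod_cast hn
  -- for every admissible `ε > 0`: `(Z t + ε)ⁿ ≤ (η + ε)ⁿ/(1 - nβ(η + ε)ⁿt)`
  have hεbound : ∀ ε : ℝ, 0 < ε → n * β * (η + ε) ^ n * t < 1 →
      (Z t + ε) ^ n ≤ (η + ε) ^ n / (1 - n * β * (η + ε) ^ n * t) := by
    intro ε hε hsmallε
    set W : ℝ → ℝ := fun s => Z s + (Φ t - Φ s) + ε with hW
    have hW' : ∀ s ∈ Icc 0 t, HasDerivWithinAt W (Z' s - φ s) (Icc 0 t) s := by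
      intro s hs
      have h1 := (((hZ s hs).add ((hasDerivWithinAt_const s (Icc 0 t) (Φ t)).sub
        (hΦ s hs))).add (hasDerivWithinAt_const s (Icc 0 t) ε))
      refine h1.congr_deriv ?_
      ring
    have hΦst : ∀ s ∈ Icc 0 t, Φ s ≤ Φ t := fun s hs => hΦmono hs htI hs.2
    have hWpos : ∀ s ∈ Icc 0 t, 0 < W s := by
      intro s hs
      have h1 := hΦst s hs
      have h2 := hZ0 s hs
      show 0 < Z s + (Φ t - Φ s) + ε
      linarith
    have hZW : ∀ s ∈ Icc 0 t, Z s ≤ W s := by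
      intro s hs
      have h1 := hΦst s hs
      show Z s ≤ Z s + (Φ t - Φ s) + ε
      linarith
    have hWle : ∀ s ∈ Icc 0 t, Z' s - φ s ≤ β * W s ^ (n + 1) := by
      intro s hs
      have h3 : Z s ^ (n + 1) ≤ W s ^ (n + 1) := pow_le_pow_left₀ (hZ0 s hs) (hZW s hs) _
      have h4 : β * Z s ^ (n + 1) ≤ β * W s ^ (n + 1) := mul_le_mul_of_nonneg_left h3 hβ
      linarith [hle s hs]
    have hW0 : W 0 = η + ε := by
      show Z 0 + (Φ t - Φ 0) + ε = η + ε
      rw [hη]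
    have hsmall' : n * β * W 0 ^ n * (t - 0) < 1 := by
      rw [hW0, sub_zero]; exact hsmallε
    have hcmp := Literature.Analysis.FluidPDE.pow_le_pow_div_of_hasDerivWithinAt_le_pow_succ hn ht
      hW' hWpos hWle htI hsmall'
    rw [hW0, sub_zero] at hcmp
    have hWt : W t = Z t + ε := by
      show Z t + (Φ t - Φ t) + ε = Z t + ε
      ring
    rwa [hWt] at hcmp
  -- pass to the limit `ε → 0⁺`
  have hden : 0 < 1 - n * β * η ^ n * t := by linarith
  have hcont : ContinuousAt (fun ε : ℝ => (η + ε) ^ n / (1 - n * β * (η + ε) ^ n * t)) 0 := by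
    have h1 : Continuous fun ε : ℝ => (η + ε) ^ n := by continuity
    have h2c : Continuous fun ε : ℝ => 1 - n * β * (η + ε) ^ n * t := by continuity
    have h2ne : (fun ε : ℝ => 1 - n * β * (η + ε) ^ n * t) 0 ≠ 0 := by
      simp only [add_zero]
      exact hden.ne'
    exact h1.continuousAt.div h2c.continuousAt h2ne
  have htend : Tendsto (fun ε : ℝ => (η + ε) ^ n / (1 - n * β * (η + ε) ^ n * t))
      (𝓝[>] 0) (𝓝 (η ^ n / (1 - n * β * η ^ n * t))) := by
    have h := hcont.tendsto
    simp only [add_zero] at h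
    exact h.mono_left nhdsWithin_le_nhds
  have htendL : Tendsto (fun ε : ℝ => (Z t + ε) ^ n) (𝓝[>] 0) (𝓝 (Z t ^ n)) := by
    have h : Continuous fun ε : ℝ => (Z t + ε) ^ n := by continuity
    have h' := h.continuousAt (x := 0) |>.tendsto
    simp only [add_zero] at h'
    exact h'.mono_left nhdsWithin_le_nhds
  have hev : ∀ᶠ ε in 𝓝[>] (0 : ℝ),
      (Z t + ε) ^ n ≤ (η + ε) ^ n / (1 - n * β * (η + ε) ^ n * t) := by
    have hopen : {ε : ℝ | n * β * (η + ε) ^ n * t < 1} ∈ 𝓝 (0 : ℝ) := by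
      have hc : Continuous fun ε : ℝ => n * β * (η + ε) ^ n * t := by continuity
      exact (isOpen_lt hc continuous_const).mem_nhds (by simpa using hsmall)
    filter_upwards [mem_nhdsWithin_of_mem_nhds hopen, self_mem_nhdsWithin] with ε h1 h2
    exact hεbound ε h2 h1
  exact le_of_tendsto_of_tendsto htendL htend hev

/-! ## §3 With a linear term: the integrating factor -/

/-- **Integrating factor + Lemma 1 (Dashti–Robinson 2008, proofs of Thms 1 and 2), every integer
power, root-free.** On `[0, t]` with one-sided derivatives within `[0, t]`: let `X ≥ 0` satisfy
`X' ≤ λX + βXⁿ⁺¹ + ψ` (`0 < n`, `β ≥ 0`, `ψ ≥ 0`), let `Λ` be an accumulated exponent (`Λ' = λ`,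
`Λ(0) = 0`, `Λ ≤ L` on `[0, t]`) and `Φ` an accumulated forcing (`Φ' = φ ≥ e^{−Λ}ψ`, `Φ(0) = 0`),
`η = X(0) + Φ(t)`. If `nβe^{nL}ηⁿt < 1` then `X(t)ⁿ ≤ e^{nΛ(t)}ηⁿ/(1 − nβe^{nL}ηⁿt)`
(`y = e^{−Λ}X` has `y' ≤ βe^{nΛ}yⁿ⁺¹ + e^{−Λ}ψ ≤ βe^{nL}yⁿ⁺¹ + φ`; then §2). The case `n = 2` is
the tree's `robustness_comparison_integral`. [cite: DashtiRobinson2008, Lemma 1 (i) with Thm 1 (proof) and Thm 2 (proof)] -/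
theorem pow_le_of_hasDerivWithinAt_le_linear_add_pow_succ_add {X Λ l Φ φ ψ : ℝ → ℝ} {β L t : ℝ}
    {n : ℕ} (hn : 0 < n) (ht : 0 < t) (hβ : 0 ≤ β)
    (hX : ∀ s ∈ Icc 0 t, ∃ D : ℝ, HasDerivWithinAt X D (Icc 0 t) s ∧
      D ≤ l s * X s + β * X s ^ (n + 1) + ψ s)
    (hX0 : ∀ s ∈ Icc 0 t, 0 ≤ X s)
    (hΛ : ∀ s ∈ Icc 0 t, HasDerivWithinAt Λ (l s) (Icc 0 t) s) (hΛ0 : Λ 0 = 0)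
    (hΛL : ∀ s ∈ Icc 0 t, Λ s ≤ L)
    (hΦ : ∀ s ∈ Icc 0 t, HasDerivWithinAt Φ (φ s) (Icc 0 t) s) (hΦ0 : Φ 0 = 0)
    (hψ0 : ∀ s ∈ Icc 0 t, 0 ≤ ψ s) (hφ : ∀ s ∈ Icc 0 t, Real.exp (-Λ s) * ψ s ≤ φ s)
    (hsmall : n * (β * Real.exp (n * L)) * (X 0 + Φ t) ^ n * t < 1) :
    X t ^ n ≤ Real.exp (n * Λ t) * (X 0 + Φ t) ^ n /
      (1 - n * (β * Real.exp (n * L)) * (X 0 + Φ t) ^ n * t) := by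
  have hU : UniqueDiffOn ℝ (Icc 0 t) := uniqueDiffOn_Icc ht
  set Z : ℝ → ℝ := fun s => Real.exp (-Λ s) * X s with hZdef
  set Z' : ℝ → ℝ := fun s => Real.exp (-Λ s) * (derivWithin X (Icc 0 t) s - l s * X s)
    with hZ'def
  set β' : ℝ := β * Real.exp (n * L) with hβ'
  have hβ'0 : 0 ≤ β' := mul_nonneg hβ (Real.exp_pos _).le
  have hZd : ∀ s ∈ Icc 0 t, HasDerivWithinAt Z (Z' s) (Icc 0 t) s := by
    intro s hs
    obtain ⟨D, hD, -⟩ := hX s hs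
    have hDs : derivWithin X (Icc 0 t) s = D := hD.derivWithin (hU s hs)
    have he : HasDerivWithinAt (fun r => Real.exp (-Λ r)) (Real.exp (-Λ s) * (-l s))
        (Icc 0 t) s := (hΛ s hs).neg.exp
    have h := he.mul hD
    rw [hZ'def]
    dsimp only
    rw [hDs]
    exact h.congr_deriv (by ring)
  have hZ0' : ∀ s ∈ Icc 0 t, 0 ≤ Z s := fun s hs => mul_nonneg (Real.exp_pos _).le (hX0 s hs)
  have hφ0 : ∀ s ∈ Icc 0 t, 0 ≤ φ s := fun s hs =>
    (mul_nonneg (Real.exp_pos _).le (hψ0 s hs)).trans (hφ s hs)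
  have hZle : ∀ s ∈ Icc 0 t, Z' s ≤ β' * Z s ^ (n + 1) + φ s := by
    intro s hs
    obtain ⟨D, hD, hDle⟩ := hX s hs
    have hDs : derivWithin X (Icc 0 t) s = D := hD.derivWithin (hU s hs)
    have hes : 0 < Real.exp (-Λ s) := Real.exp_pos _
    have h1 : Z' s ≤ Real.exp (-Λ s) * (β * X s ^ (n + 1) + ψ s) := by
      rw [hZ'def]
      dsimp only
      rw [hDs]
      exact mul_le_mul_of_nonneg_left (by linarith) hes.le
    have h2 : Real.exp (-Λ s) * (β * X s ^ (n + 1)) =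
        β * Real.exp (n * Λ s) * Z s ^ (n + 1) := by
      rw [hZdef]
      dsimp only
      have e3 : Real.exp (n * Λ s) * Real.exp (-Λ s) ^ (n + 1) = Real.exp (-Λ s) := by
        rw [← Real.exp_nat_mul, ← Real.exp_add]
        congr 1
        push_cast
        ring
      calc Real.exp (-Λ s) * (β * X s ^ (n + 1))
          = β * (Real.exp (n * Λ s) * Real.exp (-Λ s) ^ (n + 1)) * X s ^ (n + 1) := by
            rw [e3]; ring
        _ = β * Real.exp (n * Λ s) * (Real.exp (-Λ s) * X s) ^ (n + 1) := by ring
    have h3 : β * Real.exp (n * Λ s) * Z s ^ (n + 1) ≤ β' * Z s ^ (n + 1) := by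
      rw [hβ']
      have hn0 : (0 : ℝ) ≤ n := Nat.cast_nonneg n
      have hexp : Real.exp (n * Λ s) ≤ Real.exp (n * L) :=
        Real.exp_le_exp.2 (mul_le_mul_of_nonneg_left (hΛL s hs) hn0)
      exact mul_le_mul_of_nonneg_right (mul_le_mul_of_nonneg_left hexp hβ)
        (pow_nonneg (hZ0' s hs) _)
    calc Z' s ≤ Real.exp (-Λ s) * (β * X s ^ (n + 1) + ψ s) := h1
      _ = Real.exp (-Λ s) * (β * X s ^ (n + 1)) + Real.exp (-Λ s) * ψ s := by ring
      _ ≤ β' * Z s ^ (n + 1) + φ s := by rw [h2]; exact add_le_add h3 (hφ s hs)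
  have hZ0 : Z 0 = X 0 := by
    rw [hZdef]
    dsimp only
    rw [hΛ0, neg_zero, Real.exp_zero, one_mul]
  have hsmall' : n * β' * (Z 0 + (Φ t - Φ 0)) ^ n * t < 1 := by
    rw [hZ0, hΦ0, sub_zero]
    calc n * β' * (X 0 + Φ t) ^ n * t = n * (β * Real.exp (n * L)) * (X 0 + Φ t) ^ n * t := by
          rw [hβ']
      _ < 1 := hsmall
  have hcmp := pow_le_pow_div_of_hasDerivWithinAt_le_pow_succ_add hn ht hβ'0 hZd hΦ hZ0' hφ0 hZle
    hsmall'
  rw [hZ0, hΦ0, sub_zero] at hcmp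
  -- back to `X t = e^{Λ t} Z t`
  have hXt : X t = Real.exp (Λ t) * Z t := by
    rw [hZdef]
    dsimp only
    rw [← mul_assoc, ← Real.exp_add, add_neg_cancel, Real.exp_zero, one_mul]
  have hexpn : Real.exp (Λ t) ^ n = Real.exp (n * Λ t) := by
    rw [← Real.exp_nat_mul]
  rw [hXt, mul_pow, hexpn, mul_div_assoc]
  exact mul_le_mul_of_nonneg_left hcmp (Real.exp_pos _).le

/-! ## §4 From an integral balance (the shape energy methods produce) -/

/-- Monotonicity of the root-free bound `e^{E}ηⁿ/(1 − cηⁿτ)` in `η`. [folklore] -/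
private theorem fpc_bound_mono {c η η' τ E : ℝ} {n : ℕ} (hc : 0 ≤ c) (hη : 0 ≤ η)
    (hηη' : η ≤ η') (hτ : 0 ≤ τ) (hpos : 0 < 1 - c * η' ^ n * τ) :
    Real.exp E * η ^ n / (1 - c * η ^ n * τ) ≤ Real.exp E * η' ^ n / (1 - c * η' ^ n * τ) := by
  have hpow : η ^ n ≤ η' ^ n := pow_le_pow_left₀ hη hηη' n
  have h1 : c * η ^ n * τ ≤ c * η' ^ n * τ :=
    mul_le_mul_of_nonneg_right (mul_le_mul_of_nonneg_left hpow hc) hτ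
  have hnum : Real.exp E * η ^ n ≤ Real.exp E * η' ^ n :=
    mul_le_mul_of_nonneg_left hpow (Real.exp_pos _).le
  have hη'n : 0 ≤ Real.exp E * η' ^ n :=
    mul_nonneg (Real.exp_pos _).le (pow_nonneg (hη.trans hηη') n)
  calc Real.exp E * η ^ n / (1 - c * η ^ n * τ)
      ≤ Real.exp E * η' ^ n / (1 - c * η ^ n * τ) :=
        div_le_div_of_nonneg_right hnum (by linarith)
    _ ≤ Real.exp E * η' ^ n / (1 - c * η' ^ n * τ) :=
        div_le_div_of_nonneg_left hη'n hpos (by linarith)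

/-- **The forced power comparison from an INTEGRAL balance, every integer power, root-free.** Let
`X ≥ 0` be continuous on `[0, T]` with `X(b) = X(0) + ∫₀ᵇ F` (`b ∈ (0, T]`, `F` integrable on
`[0, T]`) and `F ≤ λX + βXⁿ⁺¹ + ψ` on `[0, T]` with `λ, ψ ≥ 0` continuous, `0 < n`, `β ≥ 0`; let
`Λ' = λ`, `Λ(0) = 0`, `Φ' = φ ≥ e^{−Λ}ψ`, `Φ(0) = 0` (one-sided derivatives within `[0, T]`),
`η = X(0) + Φ(T)`. If `nβe^{nΛ(T)}ηⁿT < 1` then `X(s)ⁿ ≤ e^{nΛ(s)}ηⁿ/(1 − nβe^{nΛ(T)}ηⁿs)` for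
every `s ∈ [0, T]` (no differentiability of `X`: the `C¹` super-solution
`X̂ = X(0) + ∫₀(λX + βXⁿ⁺¹ + ψ) ≥ X` obeys `X̂' ≤ λX̂ + βX̂ⁿ⁺¹ + ψ`, and §3 bounds `X̂`). The case
`n = 2` is the tree's `robustness_comparison_of_integral_balance`.
[cite: DashtiRobinson2008, Lemma 1 (i) with Thm 1 (proof) and Thm 2 (proof)] -/
theorem pow_le_of_integral_balance_le_linear_add_pow_succ_add {X F l ψ Λ Φ φ : ℝ → ℝ} {β T : ℝ}
    {n : ℕ} (hn : 0 < n) (hT : 0 < T) (hβ : 0 ≤ β) (hXc : ContinuousOn X (Icc 0 T))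
    (hF : IntegrableOn F (Icc 0 T))
    (hbal : ∀ b ∈ Ioc 0 T, X b = X 0 + ∫ s in (0 : ℝ)..b, F s)
    (hFle : ∀ s ∈ Icc 0 T, F s ≤ l s * X s + β * X s ^ (n + 1) + ψ s)
    (hX0 : ∀ s ∈ Icc 0 T, 0 ≤ X s) (hl : ContinuousOn l (Icc 0 T))
    (hψ : ContinuousOn ψ (Icc 0 T)) (hl0 : ∀ s ∈ Icc 0 T, 0 ≤ l s)
    (hψ0 : ∀ s ∈ Icc 0 T, 0 ≤ ψ s)
    (hΛ : ∀ s ∈ Icc 0 T, HasDerivWithinAt Λ (l s) (Icc 0 T) s) (hΛ0 : Λ 0 = 0)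
    (hΦ : ∀ s ∈ Icc 0 T, HasDerivWithinAt Φ (φ s) (Icc 0 T) s) (hΦ0 : Φ 0 = 0)
    (hφ : ∀ s ∈ Icc 0 T, Real.exp (-Λ s) * ψ s ≤ φ s)
    (hsmall : n * (β * Real.exp (n * Λ T)) * (X 0 + Φ T) ^ n * T < 1) {s : ℝ}
    (hs : s ∈ Icc 0 T) :
    X s ^ n ≤ Real.exp (n * Λ s) * (X 0 + Φ T) ^ n /
      (1 - n * (β * Real.exp (n * Λ T)) * (X 0 + Φ T) ^ n * s) := by
  have h0T : (0 : ℝ) ∈ Icc 0 T := left_mem_Icc.2 hT.le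
  have hTT : T ∈ Icc 0 T := right_mem_Icc.2 hT.le
  have hn0 : (0 : ℝ) ≤ n := Nat.cast_nonneg n
  -- envelopes: nonnegative, monotone
  have hφ0 : ∀ r ∈ Icc 0 T, 0 ≤ φ r := fun r hr =>
    (mul_nonneg (Real.exp_pos _).le (hψ0 r hr)).trans (hφ r hr)
  have hΛmono : MonotoneOn Λ (Icc 0 T) := fpc_monotoneOn_of_hasDerivWithinAt_nonneg hΛ hl0
  have hΦmono : MonotoneOn Φ (Icc 0 T) := fpc_monotoneOn_of_hasDerivWithinAt_nonneg hΦ hφ0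
  have hΛle : ∀ r ∈ Icc 0 T, Λ r ≤ Λ T := fun r hr => hΛmono hr hTT hr.2
  have hΦle : ∀ r ∈ Icc 0 T, Φ r ≤ Φ T := fun r hr => hΦmono hr hTT hr.2
  have hΦnn : ∀ r ∈ Icc 0 T, 0 ≤ Φ r := fun r hr => by
    have h := hΦmono h0T hr hr.1
    rwa [hΦ0] at h
  set β' : ℝ := β * Real.exp (n * Λ T) with hβ'
  have hβ'0 : 0 ≤ β' := mul_nonneg hβ (Real.exp_pos _).le
  -- the `C¹` super-solution
  have hBc : ContinuousOn (fun r => l r * X r + β * X r ^ (n + 1) + ψ r) (Icc 0 T) :=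
    ((hl.mul hXc).add (continuousOn_const.mul (hXc.pow (n + 1)))).add hψ
  obtain ⟨Xh, hXh⟩ : ∃ Xh : ℝ → ℝ,
      Xh = fun r => X 0 + ∫ x in (0 : ℝ)..r, (l x * X x + β * X x ^ (n + 1) + ψ x) := ⟨_, rfl⟩
  have hXhd : ∀ r ∈ Icc 0 T,
      HasDerivWithinAt Xh (l r * X r + β * X r ^ (n + 1) + ψ r) (Icc 0 T) r := fun r hr => by
    rw [hXh]
    exact (fpc_hasDerivWithinAt_intervalIntegral hBc hr).const_add (X 0)
  have hXh0 : Xh 0 = X 0 := by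
    rw [hXh]
    simp only [intervalIntegral.integral_same, add_zero]
  have hXle : ∀ r ∈ Icc 0 T, X r ≤ Xh r := by
    intro r hr
    rcases eq_or_lt_of_le hr.1 with h0r | h0r
    · rw [← h0r, hXh0]
    · have hsub : Icc 0 r ⊆ Icc 0 T := Icc_subset_Icc_right hr.2
      have hFi : IntervalIntegrable F volume 0 r :=
        (intervalIntegrable_iff_integrableOn_Icc_of_le h0r.le).2 (hF.mono_set hsub)
      have hBi : IntervalIntegrable (fun x => l x * X x + β * X x ^ (n + 1) + ψ x) volume 0 r :=
        (hBc.mono hsub).intervalIntegrable_of_Icc h0r.le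
      have hmono : (∫ x in (0 : ℝ)..r, F x) ≤
          ∫ x in (0 : ℝ)..r, (l x * X x + β * X x ^ (n + 1) + ψ x) :=
        intervalIntegral.integral_mono_on h0r.le hFi hBi fun x hx => hFle x (hsub hx)
      rw [hbal r ⟨h0r, hr.2⟩, hXh]
      dsimp only
      linarith
  have hXhnn : ∀ r ∈ Icc 0 T, 0 ≤ Xh r := fun r hr => (hX0 r hr).trans (hXle r hr)
  -- the bound at `s = 0`
  rcases eq_or_lt_of_le hs.1 with h0s | h0s
  · rw [← h0s, hΛ0, mul_zero, Real.exp_zero, one_mul, mul_zero, sub_zero, div_one]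
    exact pow_le_pow_left₀ (hX0 0 h0T) (by linarith [hΦnn T hTT]) n
  -- the window `[0, s]`
  have hsub : Icc 0 s ⊆ Icc 0 T := Icc_subset_Icc_right hs.2
  have hrate : ∀ r ∈ Icc 0 s, ∃ D : ℝ, HasDerivWithinAt Xh D (Icc 0 s) r ∧
      D ≤ l r * Xh r + β * Xh r ^ (n + 1) + ψ r := by
    intro r hr
    have hr' : r ∈ Icc 0 T := hsub hr
    refine ⟨_, (hXhd r hr').mono hsub, ?_⟩
    have h1 : X r ≤ Xh r := hXle r hr'
    have h2 : X r ^ (n + 1) ≤ Xh r ^ (n + 1) := pow_le_pow_left₀ (hX0 r hr') h1 _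
    have h3 : l r * X r ≤ l r * Xh r := mul_le_mul_of_nonneg_left h1 (hl0 r hr')
    have h4 : β * X r ^ (n + 1) ≤ β * Xh r ^ (n + 1) := mul_le_mul_of_nonneg_left h2 hβ
    linarith
  have hηs0 : 0 ≤ X 0 + Φ s := add_nonneg (hX0 0 h0T) (hΦnn s hs)
  have hηs : X 0 + Φ s ≤ X 0 + Φ T := by linarith [hΦle s hs]
  have hsmall_s : n * (β * Real.exp (n * Λ T)) * (Xh 0 + Φ s) ^ n * s < 1 := by
    rw [hXh0]
    have h1 : (X 0 + Φ s) ^ n * s ≤ (X 0 + Φ T) ^ n * T :=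
      mul_le_mul (pow_le_pow_left₀ hηs0 hηs n) hs.2 h0s.le (pow_nonneg (hηs0.trans hηs) n)
    calc n * (β * Real.exp (n * Λ T)) * (X 0 + Φ s) ^ n * s
        = n * β' * ((X 0 + Φ s) ^ n * s) := by rw [hβ']; ring
      _ ≤ n * β' * ((X 0 + Φ T) ^ n * T) := mul_le_mul_of_nonneg_left h1 (by positivity)
      _ = n * (β * Real.exp (n * Λ T)) * (X 0 + Φ T) ^ n * T := by rw [hβ']; ring
      _ < 1 := hsmall
  have hcmp := pow_le_of_hasDerivWithinAt_le_linear_add_pow_succ_add hn h0s hβ hrate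
    (fun r hr => hXhnn r (hsub hr))
    (fun r hr => (hΛ r (hsub hr)).mono hsub) hΛ0 (fun r hr => hΛle r (hsub hr))
    (fun r hr => (hΦ r (hsub hr)).mono hsub) hΦ0 (fun r hr => hψ0 r (hsub hr))
    (fun r hr => hφ r (hsub hr)) hsmall_s
  rw [hXh0] at hcmp
  have hXs : X s ^ n ≤ Xh s ^ n := pow_le_pow_left₀ (hX0 s hs) (hXle s hs) n
  refine (hXs.trans hcmp).trans ?_
  have hden_s : 0 < 1 - n * β' * (X 0 + Φ T) ^ n * s := by
    have h1 : n * β' * (X 0 + Φ T) ^ n * s ≤ n * β' * (X 0 + Φ T) ^ n * T :=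
      mul_le_mul_of_nonneg_left hs.2
        (mul_nonneg (mul_nonneg hn0 hβ'0) (pow_nonneg (hηs0.trans hηs) n))
    have h' : n * β' * (X 0 + Φ T) ^ n * T < 1 := by rw [hβ']; exact hsmall
    linarith
  have hmono := fpc_bound_mono (c := n * β') (E := n * Λ s) (n := n) (by positivity) hηs0 hηs
    h0s.le hden_s
  calc Real.exp (n * Λ s) * (X 0 + Φ s) ^ n /
        (1 - n * (β * Real.exp (n * Λ T)) * (X 0 + Φ s) ^ n * s)
      = Real.exp (n * Λ s) * (X 0 + Φ s) ^ n / (1 - n * β' * (X 0 + Φ s) ^ n * s) := by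
        rw [hβ']
    _ ≤ Real.exp (n * Λ s) * (X 0 + Φ T) ^ n / (1 - n * β' * (X 0 + Φ T) ^ n * s) := hmono
    _ = Real.exp (n * Λ s) * (X 0 + Φ T) ^ n /
        (1 - n * (β * Real.exp (n * Λ T)) * (X 0 + Φ T) ^ n * s) := by
        rw [hβ']

end Literature.Analysis.ODE

end
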